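/-
Copyright: pub-rosobs cell (Resolution Observatory), carver gen 39.  Companion file; statements OURS, in
the cell's polynomial weighted-centre model `W(f)`; every public declaration names the published object
it is about.  Instrument — NOT a resolution theorem.
-/
import Literature.AlgebraicGeometry.Resolution.WeightedCentreStepUmbrella
import Mathlib.FieldTheory.RatFunc.Degree
import Mathlib.FieldTheory.RatFunc.AsPolynomial
import HarnessLib

/-!
# Germs with a full directrix, and the generic point of the umbrella's axis

[cite: AbramovichTemkinWlodarczyk2024, Thm. 5.3.1 (2) (p. 1578): `inv = max (b₁,…,b_k)`, and its proof:
the first `τ` entries of the maximum read `a₁ = ord`]; [cite: CossartPiltant2008, proof of Prop. 4.2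
(`τ ≤` embedding dimension)]; [cite: Temkin2025, §1.2.2 warning (1): over `𝔽₂` the Whitney umbrella
`V(x² + y²z)` "has multiorder `(2,3,3)` at each closed point of the `z`-axis and multiorder `(2,2)` at
the generic point"].

* §1 `isMaxInv_replicate_of_mem` / `isMaxInv_replicate_of_hironakaTau_eq`: if the directrix of the
  initial form `in_ν f` uses ALL `n` variables (`τ(in_ν f) = n`), then `max W(f) = (ν, …, ν)` (`n` entries):
  every invariant has the prefix `(ν^τ)` or is smaller (`replicate_prefix_or_lt`, carver g≤36), and a
  truncation is never `TruncLex`-smaller (`not_truncLex_lt_of_prefix`).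
* §2 the ANISOTROPIC BINARY QUADRATIC `X_i² + z·X_j²` (`a² + z b² = 0 ⟹ a = b = 0` in `K`) has `τ = 2` in
  every characteristic (`hironakaTau_sq_add_C_mul_sq`, computed from translation invariance at the point
  `0`), hence in two variables `max W = (2, 2)` (`isMaxInv_sq_add_C_mul_sq`).
* §3 THE GENERIC POINT OF THE AXIS.  At the generic point of the `z`-axis of `x² + y²z ⊂ 𝔸³_K` the local
  ring has regular parameters `x, y` and residue field `K(z)`; in the completion `K(z)⟦x, y⟧` the germ is
  `x² + z·y²` with `z` transcendental, and `a² + z b² = 0` has no non-zero solution in `K(z)` (degree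
  parity, `anisotropic_ratFuncX`).  So `max W = (2, 2)` there (`isMaxInv_whitneyUmbrella_genericPoint`, every
  base field `K`, in particular `𝔽₂`) — while `WeightedCentreStepUmbrella` / `…Replay` give `(2, 3, 3)` at the
  closed points: the two halves of the printed sentence, typed.
-/

noncomputable section

open MvPolynomial

namespace Literature.AlgebraicGeometry.Resolution.WeightedBlowup

variable {k : Type*} [Field k] {n : ℕ}

/-! ## §1 Full directrix ⟹ the maximum is `(ν, …, ν)` -/

/-- A truncation is never `TruncLex`-smaller: `a <+: b ⟹ ¬ a < b` (truncated sequences are LARGER).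
[cite: AbramovichTemkinWlodarczyk2024, §5.1 (p. 1575) (order of invariants)] -/
theorem not_truncLex_lt_of_prefix : ∀ {a b : List ℚ}, a <+: b → ¬ ATW.TruncLex.lt a b
  | [], b, _ => ATW.TruncLex.not_nil_lt b
  | _ :: _, [], h => by simp at h
  | x :: xs, y :: ys, h => by
      obtain ⟨rfl, h'⟩ := List.cons_prefix_cons.mp h
      rw [ATW.TruncLex.cons_lt_cons]
      rintro (hlt | ⟨-, hlt⟩)
      · exact lt_irrefl _ hlt
      · exact not_truncLex_lt_of_prefix h' hlt

/-- **If `(ν^τ)` (`τ = τ(in_ν f)`, `ν = ord f`) is itself an invariant of `f`, it is the maximum of `W(f)`.**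
(derived here from `replicate_prefix_or_lt`) [cite: AbramovichTemkinWlodarczyk2024, Thm. 5.3.1 (2) and
its proof (p. 1578)]; [cite: CossartPiltant2008, proof of Prop. 4.2] -/
theorem isMaxInv_replicate_of_mem {f : MvPolynomial (Fin n) k} {ν : ℕ}
    (hν : monomialOrd (fun _ => 1) f = ν)
    (hmem : List.replicate (hironakaTau k {homogeneousComponent ν f}) (ν : ℚ) ∈
      admissibleInvariants f) :
    IsMaxInv (admissibleInvariants f)
      (List.replicate (hironakaTau k {homogeneousComponent ν f}) (ν : ℚ)) := by
  refine ⟨hmem, fun b hb => ?_⟩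
  obtain ⟨Ψ, γ, h, rfl⟩ := hb
  rcases replicate_prefix_or_lt hν h with hpre | hlt
  · exact not_truncLex_lt_of_prefix hpre
  · exact fun h' => ATW.TruncLex.lt_irrefl _ (ATW.TruncLex.lt_trans hlt h')

/-- **Full directrix:** `τ(in_ν f) = n` (all variables) ⟹ `max W(f) = (ν, …, ν)` (`n` entries), attained
by the coordinate centre `(X₁^ν, …, Xₙ^ν)`. (derived here) [cite: AbramovichTemkinWlodarczyk2024,
Thm. 5.3.1 (2) (p. 1578)]; [cite: CossartPiltant2008, proof of Prop. 4.2 (τ ≤ emb.dim)] -/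
theorem isMaxInv_replicate_of_hironakaTau_eq {f : MvPolynomial (Fin n) k} {ν : ℕ}
    (hν : monomialOrd (fun _ => 1) f = ν) (hν0 : 0 < ν)
    (hτ : hironakaTau k {homogeneousComponent ν f} = n) :
    IsMaxInv (admissibleInvariants f) (List.replicate n (ν : ℚ)) := by
  have h := isMaxInv_replicate_of_mem hν
    (by rw [hτ]; exact (replicate_mem_admissibleInvariants hν hν0).1)
  rwa [hτ] at h

/-! ## §2 The anisotropic binary quadratic `X_i² + z·X_j²` -/

section Quadratic

variable {N : ℕ}

/-- `X_i² + z X_j²` as a sum of two monomials (plumbing). [folklore] -/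
private theorem sq_add_C_mul_sq_eq (i j : Fin N) (z : k) :
    (X i ^ 2 + C z * X j ^ 2 : MvPolynomial (Fin N) k) =
      monomial (Finsupp.single i 2) 1 + monomial (Finsupp.single j 2) z := by
  rw [X_pow_eq_monomial, X_pow_eq_monomial, C_mul_monomial, mul_one]

/-- Support of `X_i² + z X_j²` (plumbing). [folklore] -/
private theorem mem_support_sq_add_C_mul_sq {i j : Fin N} {z : k} {d : Fin N →₀ ℕ}
    (hd : d ∈ (X i ^ 2 + C z * X j ^ 2 : MvPolynomial (Fin N) k).support) :
    d = Finsupp.single i 2 ∨ d = Finsupp.single j 2 := by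
  classical
  rw [sq_add_C_mul_sq_eq] at hd
  rcases Finset.mem_union.1 (support_add hd) with h | h
  · exact Or.inl (Finset.mem_singleton.1 (support_monomial_subset h))
  · exact Or.inr (Finset.mem_singleton.1 (support_monomial_subset h))

/-- `ord (X_i² + z X_j²) = 2` (`i ≠ j`). [cite: AbramovichTemkinWlodarczyk2024, §5.1 (a₁ = ord)] -/
theorem monomialOrd_sq_add_C_mul_sq {i j : Fin N} (hij : i ≠ j) (z : k) :
    monomialOrd (fun _ => 1) (X i ^ 2 + C z * X j ^ 2 : MvPolynomial (Fin N) k) = 2 := by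
  classical
  apply le_antisymm
  · have hmem : Finsupp.single i 2 ∈ (X i ^ 2 + C z * X j ^ 2 : MvPolynomial (Fin N) k).support := by
      rw [mem_support_iff, sq_add_C_mul_sq_eq, coeff_add, coeff_monomial, coeff_monomial, if_pos rfl,
        if_neg (fun h => hij ((Finsupp.single_left_injective (by norm_num)) h).symm)]
      simp
    refine (monomialOrd_le_weight (fun _ => 1) hmem).trans ?_
    rw [← Finsupp.degree_eq_weight_one, Finsupp.degree_single]
    norm_num
  · have h2 : ((2 : ℕ) : ℕ∞) ≤ monomialOrd (fun _ => 1) (X i ^ 2 + C z * X j ^ 2 : MvPolynomial (Fin N) k) := by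
      rw [le_monomialOrd_one_iff]
      intro d hd
      rcases mem_support_sq_add_C_mul_sq hd with rfl | rfl <;> rw [Finsupp.degree_single]
    exact_mod_cast h2

/-- `X_i² + z X_j²` is its own initial form. [cite: CossartJannsenSaito2020, Def. 8.2] -/
theorem homogeneousComponent_sq_add_C_mul_sq (i j : Fin N) (z : k) :
    homogeneousComponent 2 (X i ^ 2 + C z * X j ^ 2 : MvPolynomial (Fin N) k) =
      X i ^ 2 + C z * X j ^ 2 := by
  have h : (X i ^ 2 + C z * X j ^ 2 : MvPolynomial (Fin N) k).IsHomogeneous 2 :=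
    (isHomogeneous_X_pow i 2).add ((isHomogeneous_X_pow j 2).C_mul z)
  rw [homogeneousComponent_of_mem h, if_pos rfl]

/-- **`τ(X_i² + z X_j²) = 2` for an anisotropic form**, in every characteristic: a translation direction `w`
leaving the form invariant has `w_i² + z w_j² = 0` (evaluate at the origin), so `w_i = w_j = 0`.
(derived here) [cite: CossartJannsenSaito2020, Def. 1.26 / Lemma 1.27 (the directrix);
Temkin2025, §1.2.2 warning (1) (multiorder (2,2) at the generic point)] -/
theorem hironakaTau_sq_add_C_mul_sq {i j : Fin N} (hij : i ≠ j) {z : k}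
    (hz : ∀ a b : k, a ^ 2 + z * b ^ 2 = 0 → a = 0 ∧ b = 0) :
    hironakaTau k {(X i ^ 2 + C z * X j ^ 2 : MvPolynomial (Fin N) k)} = 2 := by
  classical
  refine (hironakaTau_singleton_eq_card (s := ({i, j} : Finset (Fin N))) ?_ ?_).trans
    (Finset.card_pair hij)
  · intro x hx
    rcases Finset.mem_union.1 (vars_add_subset _ _ hx) with h | h
    · have h' := vars_pow _ _ h
      rw [vars_X, Finset.mem_singleton] at h'
      simp [h']
    · rcases Finset.mem_union.1 (vars_mul _ _ h) with h'' | h''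
      · simp [vars_C] at h''
      · have h' := vars_pow _ _ h''
        rw [vars_X, Finset.mem_singleton] at h'
        simp [h']
  · intro w hw x hx
    have h0 := aeval_eq_of_mem_invarianceSpace hw (fun _ => (0 : k)) 1
    have h0' : w i ^ 2 + z * w j ^ 2 = 0 := by simpa using h0
    obtain ⟨hi, hj⟩ := hz _ _ h0'
    rcases Finset.mem_insert.1 hx with rfl | hx
    · exact hi
    · rw [Finset.mem_singleton.1 hx]; exact hj

/-- **In two variables an anisotropic `X₀² + z X₁²` has `max W = (2, 2)`** (the centre `(X₀², X₁²)`, i.e. the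
point with weights `(1/2, 1/2)`). (derived here) [cite: Temkin2025, §1.2.2 warning (1) (multiorder (2,2));
AbramovichTemkinWlodarczyk2024, Thm. 5.3.1 (2)] -/
theorem isMaxInv_sq_add_C_mul_sq {z : k} (hz : ∀ a b : k, a ^ 2 + z * b ^ 2 = 0 → a = 0 ∧ b = 0) :
    IsMaxInv (admissibleInvariants (X 0 ^ 2 + C z * X 1 ^ 2 : MvPolynomial (Fin 2) k)) [(2 : ℚ), 2] := by
  have h01 : (0 : Fin 2) ≠ 1 := by decide
  have h := isMaxInv_replicate_of_hironakaTau_eq (n := 2) (monomialOrd_sq_add_C_mul_sq h01 z) two_pos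
    (by rw [homogeneousComponent_sq_add_C_mul_sq]; exact hironakaTau_sq_add_C_mul_sq h01 hz)
  simpa using h

end Quadratic

/-! ## §3 The generic point of the axis: `K(z)` and `x² + z y²` -/

/-- **`a² + X b² = 0` has only the zero solution in `K(X)`** (any field `K`): `X = -(a/b)²` is impossible
since `deg X = 1` is odd and `deg (c²) = 2 deg c` is even. (derived here; degree parity) [folklore] -/
private theorem anisotropic_ratFuncX (K : Type*) [Field K] (a b : RatFunc K)
    (h : a ^ 2 + RatFunc.X * b ^ 2 = 0) : a = 0 ∧ b = 0 := by
  by_cases hb : b = 0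
  · subst hb
    simp only [ne_eq, OfNat.ofNat_ne_zero, not_false_eq_true, zero_pow, mul_zero, add_zero,
      pow_eq_zero_iff] at h
    exact ⟨h, rfl⟩
  · exfalso
    have ha : a ≠ 0 := by
      rintro rfl
      simp only [ne_eq, OfNat.ofNat_ne_zero, not_false_eq_true, zero_pow, zero_add, mul_eq_zero,
        RatFunc.X_ne_zero, false_or, pow_eq_zero_iff] at h
      exact hb h
    -- X * b² = -a², compare degrees
    have hX : RatFunc.X * b ^ 2 = -(a ^ 2) := eq_neg_of_add_eq_zero_right h
    have hdeg := congrArg RatFunc.intDegree hX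
    rw [RatFunc.intDegree_mul RatFunc.X_ne_zero (pow_ne_zero 2 hb), RatFunc.intDegree_X, pow_two,
      RatFunc.intDegree_mul hb hb, RatFunc.intDegree_neg, pow_two, RatFunc.intDegree_mul ha ha] at hdeg
    omega

/-- **The generic point of the umbrella's axis** [cite: Temkin2025, §1.2.2 warning (1) ("multiorder (2,2) at
the generic point")]: over ANY field `K`, the germ `x² + z·y² ∈ K(z)⟦x, y⟧` of `x² + y²z` at the generic point
of the `z`-axis (regular parameters `x, y`, residue field `K(z)`, `z` transcendental) has `max W = (2, 2)`.
(derived here) -/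
theorem isMaxInv_whitneyUmbrella_genericPoint (K : Type*) [Field K] :
    IsMaxInv (admissibleInvariants
      (X 0 ^ 2 + C RatFunc.X * X 1 ^ 2 : MvPolynomial (Fin 2) (RatFunc K))) [(2 : ℚ), 2] :=
  isMaxInv_sq_add_C_mul_sq (anisotropic_ratFuncX K)

end Literature.AlgebraicGeometry.Resolution.WeightedBlowup

end
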